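import Mathlib
import Summits.ValiantsHypothesis.ValiantsHypothesis.Theses.ValuativeGCT

/-!
# `CutBites` — negative lemma: NO CUT AT THRESHOLD ONE IN ODD DEGREE (parity)

Crux `stmt-ValiantsHypothesis-12626` (`Theses.ValuativeGCT.CutBites`, route ValuativeGCT).  Standing
disprover (cdisprove gen 2), `Cruxes/CutBites/Disproof.lean` §C, restated over the crux's literal
`let`-blocks so that planners / provers can import it.

* `cutBites_trunc_one_eq_trunc_zero_of_odd` — for EVERY `m`, every `δ` with `m * δ` odd and every
  weight `λ`, the crux's truncation satisfies `T 1 = T 0`: every `Stab(det_m)`-invariant form of odd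
  degree vanishes on `L_Λ = {all rows skew}`, because the transposition matrix `M_τ` lies in the
  `End`-stabiliser of `det_m` (`linSubst_swapMatrix_detFormLex`, i.e. `det Xᵀ = det X`) and acts on
  `L_Λ` as `-1`, while `(-1)^{mδ} = -1`.  The highest-weight condition is not used.
* `cutBites_no_witness_at_delta_one` — hence the natural strengthening of the crux "the cut already
  bites in degree `m`" (`δ = 1`, the crux's `∃ δ` pinned to `1`) is FALSE: refuted at `m = 3`, and
  `cutBites_finrank_trunc_one_eq_of_odd` gives equality of the two `finrank`s for every odd `m`.
  The first possible rung is `δ = 2` (attained: item evidence cutbites_evidence.md, CUTBITES_m3.md).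
[folklore]
-/

namespace Summit.ValiantsHypothesis.ValiantsHypothesis.Theorems.CutBites.Negative

open Literature.NumberTheory.DiophantineGeometry Literature.Computability.AlgebraicComplexity
open MvPolynomial
open scoped BigOperators Matrix

noncomputable section

/-- Evaluation of a homogeneous polynomial at a rescaled point (bookkeeping). [folklore] -/
theorem eval_smul_of_isHomogeneous {σ : Type*} {φ : MvPolynomial σ ℂ} {n : ℕ}
    (hφ : φ.IsHomogeneous n) (c : ℂ) (x : σ → ℂ) :
    MvPolynomial.eval (c • x) φ = c ^ n * MvPolynomial.eval x φ := by
  rw [MvPolynomial.eval_eq, MvPolynomial.eval_eq, Finset.mul_sum]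
  refine Finset.sum_congr rfl fun d hd => ?_
  have hdeg : (∑ i ∈ d.support, d i) = n := by
    have := hφ (mem_support_iff.mp hd)
    simpa [Finsupp.weight_apply, Finsupp.sum] using this
  simp only [Pi.smul_apply, smul_eq_mul, mul_pow, Finset.prod_mul_distrib,
    Finset.prod_pow_eq_pow_sum, hdeg]
  ring

/-- Vectors of `Λ_m = span {skew}` are skew. [folklore] -/
theorem skew_of_mem_span_skew {m : ℕ} {u : MatIdx m → ℂ}
    (hu : u ∈ Submodule.span ℂ {u : MatIdx m → ℂ | ∀ a b : Fin m, u (toLex (a, b)) = -u (toLex (b, a))}) (a b : Fin m) :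
    u (toLex (a, b)) = -u (toLex (b, a)) := by
  induction hu using Submodule.span_induction generalizing a b with
  | mem x hx => exact hx a b
  | zero => simp
  | add x y _ _ hx hy => rw [Pi.add_apply, Pi.add_apply, hx, hy]; ring
  | smul c x _ hx => rw [Pi.smul_apply, Pi.smul_apply, hx]; simp

/-- The permutation matrix of `X ↦ Xᵀ` acts on index-valued families by the index transposition.
[folklore] -/
theorem sum_swapMatrix_smul {m : ℕ} {N : Type*} [AddCommMonoid N] [Module ℂ N]
    (f : MatIdx m → N) (i : MatIdx m) :
    ∑ l : MatIdx m, (Matrix.of fun l i : MatIdx m => if l = toLex ((ofLex i).2, (ofLex i).1) then (1 : ℂ) else 0) l i • f l = f (toLex ((ofLex i).2, (ofLex i).1)) := by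
  simp [Matrix.of_apply, ite_smul, Finset.sum_ite_eq']

/-- `det (Xᵀ) = det X` for the generic matrix: renaming along `Prod.swap` fixes `detPoly`.
[folklore] -/
theorem rename_swap_detPoly (n : Type*) [Fintype n] [DecidableEq n] :
    rename Prod.swap (detPoly n ℂ) = detPoly n ℂ := by
  rw [detPoly, AlgHom.map_det]
  have : (rename (Prod.swap : n × n → n × n)).mapMatrix (Matrix.mvPolynomialX n n ℂ)
      = (Matrix.mvPolynomialX n n ℂ)ᵀ := by
    ext i j : 1
    simp [Matrix.mvPolynomialX, rename_X]
  rw [this, Matrix.det_transpose]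

/-- **`M_τ ∈ Stab_End(det_m)`**: the permutation matrix of the transposition fixes `det_m` under
`linSubst`. [folklore] -/
theorem linSubst_swapMatrix_detFormLex (m : ℕ) :
    linSubst (MatIdx m) ℂ (Matrix.of fun l i : MatIdx m => if l = toLex ((ofLex i).2, (ofLex i).1) then (1 : ℂ) else 0) (detFormLex ℂ m) = detFormLex ℂ m := by
  have hls : linSubst (MatIdx m) ℂ (Matrix.of fun l i : MatIdx m => if l = toLex ((ofLex i).2, (ofLex i).1) then (1 : ℂ) else 0)
      = rename (fun i : MatIdx m => toLex ((ofLex i).2, (ofLex i).1)) := by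
    refine MvPolynomial.algHom_ext fun i => ?_
    rw [linSubst_X, sum_swapMatrix_smul, rename_X]
  rw [hls, detFormLex, rename_rename]
  have : ((fun i : MatIdx m => toLex ((ofLex i).2, (ofLex i).1)) ∘ toLex : Fin m × Fin m → MatIdx m)
      = toLex ∘ Prod.swap := by
    funext ⟨a, b⟩; rfl
  rw [this, ← rename_rename, rename_swap_detPoly]

/-- **Parity.** A form of odd degree `D` on `End(ℂ^{m×m})` invariant under `A ↦ A M_τ` (transpose
every row) vanishes at every point all of whose rows are skew. [folklore] -/
theorem eval_eq_zero_of_odd_of_rowTranspose_invariant {m D : ℕ} (hD : Odd D)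
    {G : MvPolynomial (MatIdx m × MatIdx m) ℂ} (hGh : G.IsHomogeneous D)
    (hGs : MvPolynomial.aeval (R := ℂ) (fun p : MatIdx m × MatIdx m =>
      ∑ l : MatIdx m, (Matrix.of fun l i : MatIdx m => if l = toLex ((ofLex i).2, (ofLex i).1) then (1 : ℂ) else 0) l p.2 • MvPolynomial.X (p.1, l)) G = G)
    {p : MatIdx m × MatIdx m → ℂ} (hp : ∀ (j : MatIdx m) (a b : Fin m),
      p (j, toLex (a, b)) = -p (j, toLex (b, a))) :
    MvPolynomial.eval p G = 0 := by
  have hre : (MvPolynomial.aeval (R := ℂ) fun p : MatIdx m × MatIdx m =>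
      ∑ l : MatIdx m, (Matrix.of fun l i : MatIdx m => if l = toLex ((ofLex i).2, (ofLex i).1) then (1 : ℂ) else 0) l p.2 • MvPolynomial.X (p.1, l))
      = rename (fun p : MatIdx m × MatIdx m => (p.1, toLex ((ofLex p.2).2, (ofLex p.2).1))) := by
    refine MvPolynomial.algHom_ext fun p => ?_
    rw [aeval_X, rename_X]
    exact sum_swapMatrix_smul (fun l => (X (p.1, l) : MvPolynomial (MatIdx m × MatIdx m) ℂ)) p.2
  rw [hre] at hGs
  have hneg : (p ∘ fun q : MatIdx m × MatIdx m => (q.1, toLex ((ofLex q.2).2, (ofLex q.2).1)))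
      = (-1 : ℂ) • p := by
    funext q
    obtain ⟨j, i⟩ := q
    have h := hp j (ofLex i).2 (ofLex i).1
    simp only [Function.comp_apply, Pi.smul_apply, smul_eq_mul, neg_one_mul]
    simpa using h
  have h1 : MvPolynomial.eval p G
      = MvPolynomial.eval (p ∘ fun q : MatIdx m × MatIdx m =>
          (q.1, toLex ((ofLex q.2).2, (ofLex q.2).1))) G := by
    conv_lhs => rw [← hGs]
    rw [eval_rename]
  rw [hneg, eval_smul_of_isHomogeneous hGh, hD.neg_one_pow] at h1
  linear_combination h1 / 2

/-- Lattice bookkeeping: if every element of `Hom ⊓ S` lies in `P`, thresholds `1` and `0` agree.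
[folklore] -/
theorem inf_pow_one_eq_inf_pow_zero {σ : Type*} (Hom S W : Submodule ℂ (MvPolynomial σ ℂ))
    (P : Ideal (MvPolynomial σ ℂ)) (h : ∀ G ∈ Hom, G ∈ S → G ∈ P) :
    Hom ⊓ (P ^ 1).restrictScalars ℂ ⊓ S ⊓ W = Hom ⊓ (P ^ 0).restrictScalars ℂ ⊓ S ⊓ W := by
  ext G
  simp only [Submodule.mem_inf, pow_one, pow_zero, Ideal.one_eq_top, Submodule.restrictScalars_mem,
    Submodule.mem_top, and_true]
  constructor
  · rintro ⟨⟨⟨hH, -⟩, hS⟩, hW⟩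
    exact ⟨⟨hH, hS⟩, hW⟩
  · rintro ⟨⟨hH, hS⟩, hW⟩
    exact ⟨⟨⟨hH, h G hH hS⟩, hS⟩, hW⟩

/-- **No cut at threshold one in odd degree.**  For every `m`, every `δ` with `m δ` odd and every
`λ ⊢ m δ`, the crux's truncation (its `let`-blocks verbatim) has `T 1 = T 0`. [folklore] -/
theorem cutBites_trunc_one_eq_trunc_zero_of_odd (m δ : ℕ) (hodd : Odd (m * δ))
    (lam : Nat.Partition (m * δ)) :
    (let U : Submodule ℂ (MatIdx m → ℂ) :=
        Submodule.span ℂ {u : MatIdx m → ℂ | ∀ a b : Fin m, u (toLex (a, b)) = -u (toLex (b, a))};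
      let χ : Weight (MatIdx m) := (Weight.dualOfPartition (m * m) lam).toMatIdx;
      let T : ℕ → Submodule ℂ (MvPolynomial (MatIdx m × MatIdx m) ℂ) := fun t =>
        MvPolynomial.homogeneousSubmodule (MatIdx m × MatIdx m) ℂ (m * δ)
        ⊓ ((MvPolynomial.vanishingIdeal ℂ {p : MatIdx m × MatIdx m → ℂ |
              ∀ j : MatIdx m, (fun i => p (j, i)) ∈ U}) ^ (t)).restrictScalars ℂ
        ⊓ (⨅ (M : Matrix (MatIdx m) (MatIdx m) ℂ)
            (_ : linSubst (MatIdx m) ℂ M (detFormLex ℂ m) = detFormLex ℂ m),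
            LinearMap.ker ((MvPolynomial.aeval (R := ℂ) fun p : MatIdx m × MatIdx m =>
              ∑ l : MatIdx m, M l p.2 • MvPolynomial.X (p.1, l)).toLinearMap
              - LinearMap.id (R := ℂ) (M := MvPolynomial (MatIdx m × MatIdx m) ℂ)))
        ⊓ (⨅ (g : Matrix.GeneralLinearGroup (MatIdx m) ℂ) (_ : IsUpperTriangular g),
            LinearMap.ker ((MvPolynomial.aeval (R := ℂ) fun p : MatIdx m × MatIdx m =>
              ∑ l : MatIdx m, ((g⁻¹ : Matrix.GeneralLinearGroup (MatIdx m) ℂ) :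
                Matrix (MatIdx m) (MatIdx m) ℂ) p.1 l • MvPolynomial.X (l, p.2)).toLinearMap
              - weightChar χ g • LinearMap.id (R := ℂ) (M := MvPolynomial (MatIdx m × MatIdx m) ℂ)));
      T 1 = T 0) := by
  intro U χ T
  refine inf_pow_one_eq_inf_pow_zero _ _ _ _ fun G hGh hGs => ?_
  rw [MvPolynomial.mem_vanishingIdeal_iff]
  intro p hp
  have hGs' := (Submodule.mem_iInf _).mp ((Submodule.mem_iInf _).mp hGs
    (Matrix.of fun l i : MatIdx m => if l = toLex ((ofLex i).2, (ofLex i).1) then (1 : ℂ) else 0)) (linSubst_swapMatrix_detFormLex m)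
  rw [LinearMap.mem_ker, LinearMap.sub_apply, sub_eq_zero] at hGs'
  have hp' : ∀ (j : MatIdx m) (a b : Fin m), p (j, toLex (a, b)) = -p (j, toLex (b, a)) :=
    fun j a b => skew_of_mem_span_skew (hp j) a b
  simpa [MvPolynomial.coe_aeval_eq_eval] using
    eval_eq_zero_of_odd_of_rowTranspose_invariant hodd hGh hGs' hp'

/-- Corollary: for odd `m` and odd `δ` the two `finrank`s agree. [folklore] -/
theorem cutBites_finrank_trunc_one_eq_of_odd (m δ : ℕ) (hm : Odd m) (hδ : Odd δ)
    (lam : Nat.Partition (m * δ)) :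
    (let U : Submodule ℂ (MatIdx m → ℂ) :=
        Submodule.span ℂ {u : MatIdx m → ℂ | ∀ a b : Fin m, u (toLex (a, b)) = -u (toLex (b, a))};
      let χ : Weight (MatIdx m) := (Weight.dualOfPartition (m * m) lam).toMatIdx;
      let T : ℕ → Submodule ℂ (MvPolynomial (MatIdx m × MatIdx m) ℂ) := fun t =>
        MvPolynomial.homogeneousSubmodule (MatIdx m × MatIdx m) ℂ (m * δ)
        ⊓ ((MvPolynomial.vanishingIdeal ℂ {p : MatIdx m × MatIdx m → ℂ |
              ∀ j : MatIdx m, (fun i => p (j, i)) ∈ U}) ^ (t)).restrictScalars ℂ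
        ⊓ (⨅ (M : Matrix (MatIdx m) (MatIdx m) ℂ)
            (_ : linSubst (MatIdx m) ℂ M (detFormLex ℂ m) = detFormLex ℂ m),
            LinearMap.ker ((MvPolynomial.aeval (R := ℂ) fun p : MatIdx m × MatIdx m =>
              ∑ l : MatIdx m, M l p.2 • MvPolynomial.X (p.1, l)).toLinearMap
              - LinearMap.id (R := ℂ) (M := MvPolynomial (MatIdx m × MatIdx m) ℂ)))
        ⊓ (⨅ (g : Matrix.GeneralLinearGroup (MatIdx m) ℂ) (_ : IsUpperTriangular g),
            LinearMap.ker ((MvPolynomial.aeval (R := ℂ) fun p : MatIdx m × MatIdx m =>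
              ∑ l : MatIdx m, ((g⁻¹ : Matrix.GeneralLinearGroup (MatIdx m) ℂ) :
                Matrix (MatIdx m) (MatIdx m) ℂ) p.1 l • MvPolynomial.X (l, p.2)).toLinearMap
              - weightChar χ g • LinearMap.id (R := ℂ) (M := MvPolynomial (MatIdx m × MatIdx m) ℂ)));
      Module.finrank ℂ ↥(T 1) = Module.finrank ℂ ↥(T 0)) := by
  intro U χ T
  have key : T 1 = T 0 := cutBites_trunc_one_eq_trunc_zero_of_odd m δ (hm.mul hδ) lam
  rw [key]

/-- For odd `m` and odd `δ` no weight is a threshold-one witness. [folklore] -/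
theorem cutBites_not_lt_trunc_one_of_odd (m δ : ℕ) (hm : Odd m) (hδ : Odd δ)
    (lam : Nat.Partition (m * δ)) :
    (let U : Submodule ℂ (MatIdx m → ℂ) :=
        Submodule.span ℂ {u : MatIdx m → ℂ | ∀ a b : Fin m, u (toLex (a, b)) = -u (toLex (b, a))};
      let χ : Weight (MatIdx m) := (Weight.dualOfPartition (m * m) lam).toMatIdx;
      let T : ℕ → Submodule ℂ (MvPolynomial (MatIdx m × MatIdx m) ℂ) := fun t =>
        MvPolynomial.homogeneousSubmodule (MatIdx m × MatIdx m) ℂ (m * δ)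
        ⊓ ((MvPolynomial.vanishingIdeal ℂ {p : MatIdx m × MatIdx m → ℂ |
              ∀ j : MatIdx m, (fun i => p (j, i)) ∈ U}) ^ (t)).restrictScalars ℂ
        ⊓ (⨅ (M : Matrix (MatIdx m) (MatIdx m) ℂ)
            (_ : linSubst (MatIdx m) ℂ M (detFormLex ℂ m) = detFormLex ℂ m),
            LinearMap.ker ((MvPolynomial.aeval (R := ℂ) fun p : MatIdx m × MatIdx m =>
              ∑ l : MatIdx m, M l p.2 • MvPolynomial.X (p.1, l)).toLinearMap
              - LinearMap.id (R := ℂ) (M := MvPolynomial (MatIdx m × MatIdx m) ℂ)))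
        ⊓ (⨅ (g : Matrix.GeneralLinearGroup (MatIdx m) ℂ) (_ : IsUpperTriangular g),
            LinearMap.ker ((MvPolynomial.aeval (R := ℂ) fun p : MatIdx m × MatIdx m =>
              ∑ l : MatIdx m, ((g⁻¹ : Matrix.GeneralLinearGroup (MatIdx m) ℂ) :
                Matrix (MatIdx m) (MatIdx m) ℂ) p.1 l • MvPolynomial.X (l, p.2)).toLinearMap
              - weightChar χ g • LinearMap.id (R := ℂ) (M := MvPolynomial (MatIdx m × MatIdx m) ℂ)));
      ¬ (Module.finrank ℂ ↥(T 1) < Module.finrank ℂ ↥(T 0))) := by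
  intro U χ T
  have key : T 1 = T 0 := cutBites_trunc_one_eq_trunc_zero_of_odd m δ (hm.mul hδ) lam
  rw [key]
  exact lt_irrefl _

/-- **Refuted strengthening (`δ = 1`).**  The crux with its `∃ δ` pinned to `δ = 1` — "for every
odd `m ≥ 3` some weight is already cut in degree `m`" — is FALSE (witness `m = 3`; by
`cutBites_not_lt_trunc_one_of_odd` it fails at every odd `m`). [folklore] -/
theorem cutBites_no_witness_at_delta_one :
    ¬ (∀ m : ℕ, Odd m → 3 ≤ m → ∃ lam : Nat.Partition (m * 1), lam.parts.card ≤ m * m ∧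
      (let U : Submodule ℂ (MatIdx m → ℂ) :=
        Submodule.span ℂ {u : MatIdx m → ℂ | ∀ a b : Fin m, u (toLex (a, b)) = -u (toLex (b, a))};
      let χ : Weight (MatIdx m) := (Weight.dualOfPartition (m * m) lam).toMatIdx;
      let T : ℕ → Submodule ℂ (MvPolynomial (MatIdx m × MatIdx m) ℂ) := fun t =>
        MvPolynomial.homogeneousSubmodule (MatIdx m × MatIdx m) ℂ (m * 1)
        ⊓ ((MvPolynomial.vanishingIdeal ℂ {p : MatIdx m × MatIdx m → ℂ |
              ∀ j : MatIdx m, (fun i => p (j, i)) ∈ U}) ^ (t)).restrictScalars ℂ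
        ⊓ (⨅ (M : Matrix (MatIdx m) (MatIdx m) ℂ)
            (_ : linSubst (MatIdx m) ℂ M (detFormLex ℂ m) = detFormLex ℂ m),
            LinearMap.ker ((MvPolynomial.aeval (R := ℂ) fun p : MatIdx m × MatIdx m =>
              ∑ l : MatIdx m, M l p.2 • MvPolynomial.X (p.1, l)).toLinearMap
              - LinearMap.id (R := ℂ) (M := MvPolynomial (MatIdx m × MatIdx m) ℂ)))
        ⊓ (⨅ (g : Matrix.GeneralLinearGroup (MatIdx m) ℂ) (_ : IsUpperTriangular g),
            LinearMap.ker ((MvPolynomial.aeval (R := ℂ) fun p : MatIdx m × MatIdx m =>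
              ∑ l : MatIdx m, ((g⁻¹ : Matrix.GeneralLinearGroup (MatIdx m) ℂ) :
                Matrix (MatIdx m) (MatIdx m) ℂ) p.1 l • MvPolynomial.X (l, p.2)).toLinearMap
              - weightChar χ g • LinearMap.id (R := ℂ) (M := MvPolynomial (MatIdx m × MatIdx m) ℂ)));
      Module.finrank ℂ ↥(T 1) < Module.finrank ℂ ↥(T 0))) := by
  intro h
  obtain ⟨lam, -, hlt⟩ := h 3 (by decide) le_rfl
  exact cutBites_not_lt_trunc_one_of_odd 3 1 (by decide) odd_one lam hlt

end

end Summit.ValiantsHypothesis.ValiantsHypothesis.Theorems.CutBites.Negative
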